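import Summits.CriticalPhenomena.CardyFormulaZ2.Theorems.CardyMeckeFlipLawToCrossingsUpper
import Literature.Probability.Percolation.RSWLemma
import Literature.Probability.Percolation.CrossingChains
import Literature.Probability.Percolation.LatticeTraceBlocking
import Literature.Topology.PlaneTopology.StripCrossings
import HarnessLib

/-!
# Lattice RSW for `3a × a` rectangle quads, eventually in the mesh

Support file for the crux `Z2LimitsSymmetric` (stmt-CriticalPhenomena-14827) of route
`CardyMeckeFlip`, sub-problem `CardyFormulaZ2`: the registered stub `stub_latticeRSWQuads` of the
line `registered` (`Cruxes/Z2LimitsSymmetric/Lines/birth.lean`).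

**Statement.**  There is ONE constant `c > 0` such that for every axis-parallel rectangle quad
`Q` of the plane with carrier `[x, x + 3a] × [y, y + a]` (`a > 0`) whose sides `0` / `2` are its
left / right edges, for all sufficiently small meshes `δ > 0` the law `μ_δ = z2QuadLaw univ δ` of
critical bond percolation on `δℤ²` in the Schramm–Smirnov space `ℋ_ℂ` gives the crossing event
`⊞_Q` probability at least `c`.

**Proof.**  `c` is the Russo–Seymour–Welsh constant of `rsw_half_holds` at aspect ratio `4`.
For `0 < δ < a / 16` put `u = (⌊x/δ⌋, ⌈y/δ⌉)`, `M = ⌈(x + 3a)/δ⌉ - ⌊x/δ⌋`,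
`n = ⌊(y + a)/δ⌋ - ⌈y/δ⌉`; then `1 ≤ n`, `M ≤ 4n`, so the translated lattice box
`u + [0, M] × [0, n]` is crossed from left to right with probability
`crossingProb ½ M n ≥ crossingProb ½ (4n) n ≥ c` (`bondPercolation_real_lrCrossingAt`,
`crossingProb_anti_left`).  On that event (and `ω ⊆ E(ℤ²)`, which holds almost surely) the open
crossing is a lattice walk (`exists_walk_of_mem_lrCrossingAt`) whose drawn trace `meshTrace δ T`
is a continuum inside the horizontal band `y ≤ im ≤ y + a`, inside the drawn open edges, joining
`{re ≤ x}` to `{re ≥ x + 3a}`; a sub-continuum inside the strip `x ≤ re ≤ x + 3a` meeting both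
lines (`exists_subcontinuum_between_lines`) is a crossing of `Q`, so `Q ∈ S_ω`
(`mem_z2QuadConfig_of_isCrossing`).  Finally `μ_δ(⊞_Q) = P_{1/2}(S_ω ∋ Q)` (`z2QuadLaw_apply`).

References: G. Grimmett, *Percolation* (1999), §11.7; O. Schramm, S. Smirnov, Ann. Probab. 39
(2011), §1.3.
-/

noncomputable section

open Set Filter MeasureTheory Metric Complex
open scoped Topology ENNReal
open Literature.Probability.Percolation Literature.Probability.Percolation.QuadCrossing
open Literature.Probability.LatticeModels
open Literature.Topology.PlaneTopology

namespace Summit.CriticalPhenomena.CardyFormulaZ2.Cruxes.Z2LimitsSymmetric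

/-! ### Drawn traces of lattice walks -/

/-- The mesh trace of a lattice walk all of whose edges are open lies inside the drawn open
edges `openEdgeUnion δ ω`. -/
theorem meshTrace_subset_openEdgeUnion {δ : ℝ} {ω : BondConfig (Site 2)} {p q : Site 2}
    (T : (zdGraph 2).Walk p q) (hT : ∀ e ∈ T.edges, e ∈ ω) :
    meshTrace δ T ⊆ openEdgeUnion δ ω := by
  intro z hz
  obtain ⟨e, he, hze⟩ := mem_meshTrace_iff.1 hz
  have hadj : e ∈ (zdGraph 2).edgeSet := T.edges_subset_edgeSet he
  revert hadj hze he
  induction e using Sym2.ind with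
  | h x y =>
    intro he hze hadj
    rw [SimpleGraph.mem_edgeSet] at hadj
    rw [← segment_meshPoint_eq_image] at hze
    exact mem_openEdgeUnion_iff.2 ⟨x, y, hadj, hT _ he, hze⟩

/-- The mesh trace of a lattice walk lies in every convex set containing the mesh points of its
vertices. -/
theorem meshTrace_subset_of_convex {δ : ℝ} {p q : Site 2} (T : (zdGraph 2).Walk p q)
    {C : Set ℂ} (hC : Convex ℝ C) (hs : ∀ z ∈ T.support, meshPoint δ z ∈ C) :
    meshTrace δ T ⊆ C := by
  intro z hz
  obtain ⟨e, he, hze⟩ := mem_meshTrace_iff.1 hz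
  revert hze he
  induction e using Sym2.ind with
  | h x y =>
    intro he hze
    rw [← segment_meshPoint_eq_image] at hze
    exact hC.segment_subset (hs x (T.fst_mem_support_of_mem_edges he))
      (hs y (T.snd_mem_support_of_mem_edges he)) hze

/-! ### An open crossing of a suitable lattice box crosses the rectangle quad -/

/-- **An open left-right crossing of a lattice box slightly wider than, and vertically inside,
the rectangle `[x, x + 3a] × [y, y + a]` crosses the quad `Q` on it.**  If the box
`u + [0, M] × [0, n]` at mesh `δ` has its left column at `re ≤ x`, its right column at
`re ≥ x + 3a` and its rows inside `y ≤ im ≤ y + a`, then on `LR(u + [0, M] × [0, n])` (for a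
lattice configuration `ω ⊆ E(ℤ²)`) the quad `Q` with carrier `[x, x + 3a] × [y, y + a]` and sides
`0` / `2` its left / right edges belongs to `S_ω = z2QuadConfig univ δ ω`. -/
theorem mem_z2QuadConfig_of_mem_lrCrossingAt {a x y δ : ℝ} (ha : 0 < a)
    {Q : Quad (univ : Set ℂ)}
    (hQc : Q.carrier = {w : ℂ | x ≤ w.re ∧ w.re ≤ x + 3 * a ∧ y ≤ w.im ∧ w.im ≤ y + a})
    (hQ0 : Q.side 0 = {w : ℂ | w.re = x ∧ y ≤ w.im ∧ w.im ≤ y + a})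
    (hQ2 : Q.side 2 = {w : ℂ | w.re = x + 3 * a ∧ y ≤ w.im ∧ w.im ≤ y + a})
    {u : Site 2} {M n : ℕ} (hx0 : δ * (u 0 : ℝ) ≤ x) (hx1 : x + 3 * a ≤ δ * ((u 0 : ℝ) + M))
    (hy0 : y ≤ δ * (u 1 : ℝ)) (hy1 : δ * ((u 1 : ℝ) + n) ≤ y + a) (hδ : 0 ≤ δ)
    {ω : BondConfig (Site 2)} (hω : ω ⊆ (zdGraph 2).edgeSet) (hcr : ω ∈ lrCrossingAt u M n) :
    Q ∈ z2QuadConfig (univ : Set ℂ) δ ω := by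
  obtain ⟨p, q, T, hp, hq, hsupp, hedges⟩ := exists_walk_of_mem_lrCrossingAt hω hcr
  -- the walk is not trivial: its ends are `δ M ≥ 3a > 0` apart
  have hTn : ¬ T.Nil := by
    intro hnil
    have hpq : p = q := hnil.eq
    have hM : M = 0 := by
      have h := hq
      rw [← hpq, hp] at h
      omega
    have hM' : (M : ℝ) = 0 := by exact_mod_cast hM
    rw [hM', add_zero] at hx1
    linarith
  -- the horizontal band containing the drawn trace
  set B : Set ℂ := {w : ℂ | y ≤ w.im ∧ w.im ≤ y + a} with hB
  have hBconv : Convex ℝ B := by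
    simpa only [hB, setOf_and] using
      (convex_halfSpace_im_ge y).inter (convex_halfSpace_im_le (y + a))
  have hLB : meshTrace δ T ⊆ B := by
    refine meshTrace_subset_of_convex T hBconv fun z hz => ?_
    obtain ⟨-, -, h1, h2⟩ := hsupp z hz
    have h1' : (u 1 : ℝ) ≤ z 1 := by exact_mod_cast h1
    have h2' : (z 1 : ℝ) ≤ u 1 + n := by exact_mod_cast h2
    have h1'' := mul_le_mul_of_nonneg_left h1' hδ
    have h2'' := mul_le_mul_of_nonneg_left h2' hδ
    refine ⟨?_, ?_⟩
    · rw [meshPoint_im]; linarith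
    · rw [meshPoint_im]; linarith
  have hLO : meshTrace δ T ⊆ openEdgeUnion δ ω := meshTrace_subset_openEdgeUnion T hedges
  have hpL : meshPoint δ p ∈ meshTrace δ T :=
    meshPoint_mem_meshTrace_of_mem_support hTn T.start_mem_support
  have hqL : meshPoint δ q ∈ meshTrace δ T :=
    meshPoint_mem_meshTrace_of_mem_support hTn T.end_mem_support
  have hpre : (meshPoint δ p).re ≤ x := by rw [meshPoint_re, hp]; exact hx0
  have hqre : x + 3 * a ≤ (meshPoint δ q).re := by
    rw [meshPoint_re, hq]; push_cast; exact hx1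
  -- a sub-continuum inside the vertical strip `x ≤ re ≤ x + 3a` meeting both lines
  obtain ⟨K, hKL, hKc, hKconn, hKsub, ⟨z₀, hz₀, hz₀re⟩, ⟨z₂, hz₂, hz₂re⟩⟩ :=
    exists_subcontinuum_between_lines (a := x) (b := x + 3 * a) (by linarith)
      (isCompact_meshTrace δ T) (isPreconnected_meshTrace δ T) ⟨_, hpL, hpre⟩ ⟨_, hqL, hqre⟩
  refine mem_z2QuadConfig_of_isCrossing (K := K)
    ⟨hKc, ⟨⟨z₀, hz₀⟩, hKconn⟩, ?_, ?_, ?_⟩ (hKL.trans hLO)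
  · intro z hz
    rw [hQc]
    exact ⟨(hKsub z hz).1, (hKsub z hz).2, (hLB (hKL hz)).1, (hLB (hKL hz)).2⟩
  · refine ⟨z₀, hz₀, ?_⟩
    rw [hQ0]
    exact ⟨hz₀re, (hLB (hKL hz₀)).1, (hLB (hKL hz₀)).2⟩
  · refine ⟨z₂, hz₂, ?_⟩
    rw [hQ2]
    exact ⟨hz₂re, (hLB (hKL hz₂)).1, (hLB (hKL hz₂)).2⟩

/-! ### The registered stub -/

/-- **S4 — `stub_latticeRSWQuads`: Russo–Seymour–Welsh for `3a × a` rectangle quads, at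
lattice level, eventually in the mesh.**  ONE constant `c > 0` (the constant of `rsw_half_holds`
at aspect ratio `4`) such that for every axis-parallel rectangle quad `Q` with carrier
`[x, x + 3a] × [y, y + a]` and sides `0` / `2` its left / right edges, `c ≤ μ_δ(⊞_Q)` for all
`0 < δ < a / 16`: the lattice box `(⌊x/δ⌋, ⌈y/δ⌉) + [0, M] × [0, n]`,
`M = ⌈(x + 3a)/δ⌉ - ⌊x/δ⌋ ≤ 4n`, `n = ⌊(y + a)/δ⌋ - ⌈y/δ⌉ ≥ 1`, is crossed with probability
`≥ crossingProb ½ (4n) n ≥ c` (`crossingProb_anti_left`, translation invariance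
`bondPercolation_real_lrCrossingAt`), and such a crossing crosses `Q`
(`mem_z2QuadConfig_of_mem_lrCrossingAt`).  Grimmett (1999) §11.7; Schramm–Smirnov (2011) §1.3. -/
theorem stub_latticeRSWQuads : open Literature.Probability.Percolation.QuadCrossing in ∃ c : ℝ, 0 < c ∧ ∀ (a x y : ℝ), 0 < a → ∀ Q : Quad (Set.univ : Set ℂ), Q.carrier = {w : ℂ | x ≤ w.re ∧ w.re ≤ x + 3 * a ∧ y ≤ w.im ∧ w.im ≤ y + a} → Q.side 0 = {w : ℂ | w.re = x ∧ y ≤ w.im ∧ w.im ≤ y + a} → Q.side 2 = {w : ℂ | w.re = x + 3 * a ∧ y ≤ w.im ∧ w.im ≤ y + a} → ∀ᶠ δ in nhdsWithin (0 : ℝ) (Set.Ioi 0), c ≤ ((Literature.Probability.Percolation.z2QuadLaw (Set.univ : Set ℂ) δ : MeasureTheory.FiniteMeasure (QuadConfig (Set.univ : Set ℂ))) : MeasureTheory.Measure (QuadConfig (Set.univ : Set ℂ))).real (QuadConfig.crossedEvent Q) := by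
  obtain ⟨c, hc, hrsw⟩ := rsw_half_holds 4 (by norm_num)
  refine ⟨c, hc, fun a x y ha Q hQc hQ0 hQ2 => ?_⟩
  have ha16 : 0 < a / 16 := by positivity
  filter_upwards [Ioo_mem_nhdsGT ha16] with δ hδ
  obtain ⟨hδ0, hδa⟩ := hδ
  have haδ : 16 < a / δ := by
    rw [lt_div_iff₀ hδ0]
    rw [lt_div_iff₀ (by norm_num : (0 : ℝ) < 16)] at hδa
    linarith
  -- the four roundings
  obtain ⟨fx, h1, h1'⟩ : ∃ k : ℤ, (k : ℝ) ≤ x / δ ∧ x / δ < k + 1 :=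
    ⟨⌊x / δ⌋, Int.floor_le _, Int.lt_floor_add_one _⟩
  obtain ⟨cx, h2, h2'⟩ : ∃ k : ℤ, (x + 3 * a) / δ ≤ k ∧ (k : ℝ) < (x + 3 * a) / δ + 1 :=
    ⟨⌈(x + 3 * a) / δ⌉, Int.le_ceil _, Int.ceil_lt_add_one _⟩
  obtain ⟨cy, h3, h3'⟩ : ∃ k : ℤ, y / δ ≤ k ∧ (k : ℝ) < y / δ + 1 :=
    ⟨⌈y / δ⌉, Int.le_ceil _, Int.ceil_lt_add_one _⟩
  obtain ⟨fy, h4, h4'⟩ : ∃ k : ℤ, (k : ℝ) ≤ (y + a) / δ ∧ (y + a) / δ < k + 1 :=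
    ⟨⌊(y + a) / δ⌋, Int.floor_le _, Int.lt_floor_add_one _⟩
  have hxa : (x + 3 * a) / δ = x / δ + 3 * (a / δ) := by rw [add_div, mul_div_assoc]
  have hya : (y + a) / δ = y / δ + a / δ := add_div _ _ _
  have hM0 : (fx : ℝ) < cx := by linarith
  have hM0' : fx < cx := by exact_mod_cast hM0
  have hn0 : (cy : ℝ) + 1 < fy := by linarith
  have hn0' : cy + 1 < fy := by exact_mod_cast hn0
  have hMn : ((cx - fx : ℤ) : ℝ) < 4 * ((fy - cy : ℤ) : ℝ) := by push_cast; linarith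
  have hMn' : cx - fx < 4 * (fy - cy) := by exact_mod_cast hMn
  obtain ⟨M, hM⟩ : ∃ M : ℕ, (M : ℤ) = cx - fx := ⟨(cx - fx).toNat, by omega⟩
  obtain ⟨n, hn⟩ : ∃ n : ℕ, (n : ℤ) = fy - cy := ⟨(fy - cy).toNat, by omega⟩
  have hMle : M ≤ 4 * n := by omega
  have hn1 : 1 ≤ n := by omega
  -- the RSW bound for the `M × n` box
  have hfloor : ⌊(4 : ℝ) * (n : ℝ)⌋₊ = 4 * n := by
    rw [show (4 : ℝ) * (n : ℝ) = ((4 * n : ℕ) : ℝ) by push_cast; ring, Nat.floor_natCast]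
  have hcross : c ≤ crossingProb half M n := by
    have h := hrsw n (by rw [hfloor]; omega)
    rw [hfloor] at h
    exact h.1.trans (crossingProb_anti_left half hMle n)
  -- the position of the box
  set u : Site 2 := ![fx, cy] with hu
  have hu0 : u 0 = fx := rfl
  have hu1 : u 1 = cy := rfl
  have hMr : (M : ℝ) = cx - fx := by exact_mod_cast hM
  have hnr : (n : ℝ) = fy - cy := by exact_mod_cast hn
  have hx0 : δ * (u 0 : ℝ) ≤ x := by
    rw [hu0, mul_comm]; exact (le_div_iff₀ hδ0).1 h1
  have hx1 : x + 3 * a ≤ δ * ((u 0 : ℝ) + M) := by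
    rw [hu0, hMr, show δ * ((fx : ℝ) + (cx - fx)) = cx * δ by ring]
    exact (div_le_iff₀ hδ0).1 h2
  have hy0 : y ≤ δ * (u 1 : ℝ) := by
    rw [hu1, mul_comm]; exact (div_le_iff₀ hδ0).1 h3
  have hy1 : δ * ((u 1 : ℝ) + n) ≤ y + a := by
    rw [hu1, hnr, show δ * ((cy : ℝ) + (fy - cy)) = fy * δ by ring]
    exact (le_div_iff₀ hδ0).1 h4
  -- the event inclusion, almost surely, and the push-forward
  have hae : ∀ᵐ ω ∂bondPercolation (zdGraph 2) half, ω ⊆ (zdGraph 2).edgeSet :=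
    ProbabilityTheory.setBernoulli_ae_subset
  have hmono : bondPercolation (zdGraph 2) half (lrCrossingAt u M n) ≤
      bondPercolation (zdGraph 2) half
        (z2QuadConfig (univ : Set ℂ) δ ⁻¹' QuadConfig.crossedEvent Q) :=
    measure_mono_ae (hae.mono fun ω hω hcr =>
      mem_z2QuadConfig_of_mem_lrCrossingAt ha hQc hQ0 hQ2 hx0 hx1 hy0 hy1 hδ0.le hω hcr)
  rw [measureReal_def, z2QuadLaw_apply isOpen_univ hδ0 (QuadConfig.measurableSet_crossedEvent Q)]
  calc c ≤ crossingProb half M n := hcross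
    _ = (bondPercolation (zdGraph 2) half).real (lrCrossingAt u M n) :=
      (bondPercolation_real_lrCrossingAt half u M n).symm
    _ ≤ _ := ENNReal.toReal_mono (measure_ne_top _ _) hmono

end Summit.CriticalPhenomena.CardyFormulaZ2.Cruxes.Z2LimitsSymmetric

end
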